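import Summits.QuantumFields.BalabanUV.T4Continuum.Support.B13Represents
import Summits.QuantumFields.BalabanUV.T4Continuum.Support.B13TermRep
import Summits.QuantumFields.BalabanUV.T4Continuum.Support.B13StepTermExpLinear
import Literature.MathematicalPhysics.QuantumFieldTheory.Balaban1983to89.T4InputCauchyRateSecant

/-!
# NE5 ∕ U3 — O2-hist (STRUCTURAL), SECANT FACE: the reach-free class-wide history modulus `HistSecant` of leaf L04 for the
# Ursell term family `B13StepTermFamily.term 𝒯 inc act` and for the model of record `B13Represents.Assembly.step`, AT ACTIVITY
# LEVEL — the secant of an Ursell term under the product integral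

Cell `pub-balaban`, unit `b2b-balaban-t4-ne5-formalise-leaf-03` (NE5 formalisation swarm, LEAF PROVER 03, gen 2; journal INTENT
`CLAIMS.log` l.6438; `t4/formal/NE5/LEAVES.md` v1.3 row «O2-hist (L04 history half) … via `TermHistExpLinear` ∕
`histSecant_of_expLinear` from O1-d2's (μ, Φ, Λ)»; companion file `Support/B13TermHistEnvelope.lean` = the Cauchy face).
Summits-side new work under the LEAN PLACEMENT RULE (cell bookkeeping + kernel analysis; NOT a Literature module).
HONEST FRAMING: rung (B)+1 of the FINITE-VOLUME T⁴ continuum programme — NOT infinite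
volume, NOT a mass gap, NOT the Clay problem, NOT a proof of NE5 (NOT PRINTED in [Balaban1987RG1]–[Balaban1989LargeFieldII]:
they print ε-UNIFORM bounds, never η-RATES; cell GAPS G-t4-U3-1).  HONEST DEPENDENCY (cell line, verbatim): continuum YM on T⁴ ⇐
BetaPertH ∧ nine spine estimates (0/9 proved); BetaPertH ⇐ (D1) ∧ (D4) ∧ CAP+tail; G-an2-4 gates asym, D1 and NE2/3/4.

WHERE IT SITS.  Leaf L04 of the owner's skeleton (`SKELETON-NE5-P1.md`) is the two-species output wall W2; its OPERATOR half
(`OpFibreEnvelope[Cl]` ∕ `OpLipschitz`, wall O2-op — mathematics not in print, trigger c6) is NOT touched here.  For its HISTORY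
half the tree has, besides the Cauchy face, the SECANT FACE `T4InputCauchyRateSecant`: `HistSecant M K W κ Λhist` — for any two
class points with the same operator datum the step output differs by `≤ Λhist·(‖h′ − h‖∕rHist)·e^{−κd(X)}`, NO reach, NO slack,
NO room, NO analyticity — produced over an abstract term family by `histSecant_of_expLinear` from `TermRep`, NAMED exponent
bounds (`TermHistExpLinearN`), ABSOLUTE majorants (`ExpLinearAbsBound`) and a first-moment budget, and consumed as the binder
`hsec` of the END faces `ne5_at_of_stepModel_secant_nat` ∕ `…_secant_scale_nat`.  Row O1-d2 (leaf-08) typed [Balaban1988RG2Cluster]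
(2.13) as the Ursell terms `term 𝒯 inc act` of ACTIVITY TERMS and EXHIBITED their exp-linear history structure from the
per-activity structure `ActExpLinearOn 𝒯 act D K W` with product data `tupleMeasure`∕`tupleWeight`∕`tupleFunctional`
(`termHistExpLinear_of_actExpLinear`, p207797; for route P2's term data with linear read-outs `B13StepTermExpLinear`, p208225);
row O1-d3 (leaf-04) split the termwise majorant into an ACTIVITY majorant and the PER-DOMAIN combinatorial majorant
`B13TermRep.actMajorant` (p208307; the per-domain currency row O1-d1 showed necessary for absolute labels, journal l.5621); row
O1-e (leaf-09) assembled the model of record `Assembly.step` with `Out = out 𝒯 inc act` by `rfl` (p208313); row O1-c part 3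
(leaf-06) typed the measurable history space `B13HistM` carrying the structure's measurability clause (p208258).  THIS FILE
produces `HistSecant` AT ACTIVITY LEVEL — every remaining input a PER-ACTIVITY displayed binder of printed KIND — proving the
one piece of analysis that level needs: the secant of an Ursell term under the product integral.

WHAT IS PROVED (kernel; `[folklore]` throughout; nothing of the manuscripts under audit is asserted — every input is DATA, a
STRUCTURE shape or a displayed one-run binder with a KIND locator, trigger c3∕c4):
* §1 two PARAMETRISED per-activity hypothesis SHAPES, asserted nowhere: `ActExpNormBound 𝒯 D K W r N` (NAMED a.e. bound of the
  factor's history functional in units `r k`, `‖D.Λ Z j q.1 a‖·r k ≤ N k g U Z j`; printed KIND: the `τ(Y)` of (2.14) p. 15 on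
  the circles (2.18) p. 16 and the estimate (2.20) p. 16 — locators only) and `ActAbsBound 𝒯 D K W A` (ABSOLUTE activity
  majorant `∫ ‖D.Φ Z j q.1 a‖·‖exp(D.Λ Z j q.1 a q.2)‖ dν ≤ A k g U Z j`; printed KIND: (2.15) p. 15 — the modulus of (2.14)
  with `exp Σ|τ(Y)||𝐕_k(Y,B)|` — and Lemma 3 (2.38) p. 20; locators only); `actNormBound_of_abs` (absolute ⟹ norm majorant:
  leaf-04's `termRep_b13_of_actBound`∕`classBound_b13_of_actBound` and the Cauchy face consume the SAME datum `A`);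
  `secMajorant N A k X i := (Σ_m N_m)·actMajorant A k X i`; `absMajorant_tuple_le` (the ENDPOINT absolute majorant of an Ursell
  term is `≤ actMajorant`: Fubini on `Measure.pi`, `integral_fintype_prod_eq_prod`, and `‖exp Σ‖ = Π‖exp‖`);
  `normBound_tupleFunctional` (the tuple functional is a.e. `≤ (Σ_m N_m)∕r k`, bounds transported along the evaluations,
  `Measure.tendsto_eval_ae_ae`); **`norm_term_sub_term_le`**: at two class points `(o,h)`, `(o,h′)` of step `k`,
  `‖term k i o h′ X − term k i o h X‖ ≤ 2·secMajorant·(‖h′ − h‖∕rHist k)` — the tree's kernel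
  `T4InputCauchyRateSecant.norm_integral_mul_cexp_sub_le` (secant of the exponential under the integral sign) on leaf-08's
  product data; **`histSecant_b13_of_act`**: `M.Out = out 𝒯 inc act` ∧ `ActExpLinearOn` ∧ `ActExpNormBound … M.rHist N` ∧
  `ActAbsBound … A` ∧ `N ≥ 0` ∧ d3's convergence binder `Summable (actMajorant (A k g U) k X)` ∧ a PER-DOMAIN FIRST-MOMENT
  budget `Σ'ᵢ secMajorant ≤ G₁·e^{−κd(X)}` ⟹ **`HistSecant M K W κ (2G₁)`** (NO END face is re-wired here).
* §2 the same for the MODEL OF RECORD: `histSecant_step_of_act` (`𝔄.step BHist`, `hM := rfl`; any class, NO room, NO slack).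
* §3 ROUTE P2's TERM DATA with linear read-outs (`act = actOf 𝔱`, `D = dataOf 𝔱 L`, leaf-08's `LinearHistoryOn`): the
  exponent bound DISCHARGED BY NAME from `B13StepTermExpLinear.norm_histCLM_le` (`actExpNormBound_of_readUnitBound` ∕
  `actExpNormBound_of_linearHistory`: `N k g U Z j = r k·(Σ_{Y∈𝐃(Z,j)} v Y)∕ϱ Z j`, everywhere, not only a.e.; for the B13
  read-out through the measurable table the inputs are leaf-06's `B13HistReadout.readVpp_eq_clm`∕`readUnitBound_readVpp`,
  p209145); the IDENTIFICATION of the absolute majorant's integrand with P2's tilted integrand over the normalisation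
  (`absIntegrand_weight_eq`:
  `‖Φ‖·‖e^{Λ h}‖ = ‖(z o)⁻¹‖·‖F (o,h) x‖`), so that `ActAbsBound` for `dataOf 𝔱 L` READS `‖(z o)⁻¹‖·∫‖F (o,h)‖dν ≤ A` — the
  (2.15) quantity of P2's `RefAt.hF`∕`hM'`∕`hζ` KIND (`actAbsBound_of_normF` ∕ `actAbsBound_of_linearHistory_normF`).
WHAT IS *NOT* HERE (honest).  No estimate on Bałaban's objects: the activity majorants `A` ((2.38) KIND), the exponent bounds
`N` where not read from P2's `ReadUnitBound` ((2.20) KIND) and the per-domain budgets ((2.41)∕[26] KIND — leaf-08's follower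
(iii), the tree-graph summation, in progress) stay DISPLAYED; the instantiation of `𝒯`, `act`, `D` on [II]'s (2.14) terms is
the instancer's (rows O1-a∕O4-r); O2-op, O3, O5 are walls (c6), untouched.  Headline discipline (c5): «NE5 leaf L04-hist
PRODUCED STRUCTURALLY (secant face) for the Ursell term family ∕ model of record, modulo displayed per-activity one-run binders
of printed KIND» — NOT «L04 proved», NOT «NE5 proved»; 0∕12 leaves instantiated on Bałaban's objects is unchanged by this file.
`FlowStep.BetaPertH`, (B), (B^μ) do not occur.  0 sorry; axioms ⊆ {propext, Classical.choice, Quot.sound}.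
-/

noncomputable section

open MeasureTheory Metric Set
open scoped BigOperators

namespace Summit.QuantumFields.BalabanUV.T4Continuum.B13TermHistSecant

open Literature.MathematicalPhysics.QuantumFieldTheory.Balaban1983to89.T4OutputRate (Carriers)
open Literature.MathematicalPhysics.QuantumFieldTheory.Balaban1983to89.T4InputCauchyRateData (StepModel)
open Literature.MathematicalPhysics.QuantumFieldTheory.Balaban1983to89.T4InputCauchyRateSecant
  (HistSecant norm_integral_mul_cexp_sub_le)
open Summit.QuantumFields.BalabanUV.T4Continuum.B13StepTermFamily
  (TermIndexing ActData ActExpLinearOn coeff term out hasSum_term_out term_of_rel term_of_not_rel tupleMeasure tupleWeight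
    tupleFunctional termHistExpLinear_of_actExpLinear)
open Summit.QuantumFields.BalabanUV.T4Continuum.B13TermRep
  (actMajorant actMajorant_of_rel actMajorant_of_not_rel actMajorant_nonneg summable_term_of_actBound)
open Summit.QuantumFields.BalabanUV.T4Continuum.B13StepTermExpLinear
  (histCLM weight actOf dataOf LinearHistoryOn norm_histCLM_le F_eq_mul_cexp)
open Literature.MathematicalPhysics.QuantumFieldTheory.Balaban1983to89.T4ActivityTiltHistory (ReadUnitBound)
open Summit.QuantumFields.BalabanUV.T4Continuum.ActivityTermModel (TermDatum)
open Summit.QuantumFields.BalabanUV.T4Continuum.B13OpDatum (OpDatum)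
open Summit.QuantumFields.BalabanUV.T4Continuum.B13Represents (Assembly)

/-! ## §1 The secant face at activity level: per-activity exponent bounds and absolute majorants ⟹ `HistSecant` -/

section Secant

variable {C : Carriers} {ι P J Op Hist Ω : Type*} [NormedAddCommGroup Hist] [NormedSpace ℂ Hist] [MeasurableSpace Ω]
  (𝒯 : TermIndexing C ι P J) (inc : P → P → Prop) [DecidableRel inc] (act : P → J → Op → Hist → ℂ)
  (D : ActData P J Op Hist Ω)

/-- [folklore] HYPOTHESIS SHAPE `ActExpNormBound 𝒯 D K W r N` (PARAMETRISED, asserted nowhere; printed KIND: in the resummed term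
(2.14) p. 15 of [Balaban1988RG2Cluster] the earlier potentials enter through `exp[Σ_{Y∈𝐃} τ(Y)𝐕_k(Y,B)]` with `τ(Y)` on the
circles (2.18) p. 16 — radius the INVERSE of the potentials' unit level times `α₄` — and the estimate (2.20) p. 16; a UNIFORM
per-activity bound is the reading of p. 17's absorption of the field∕volume factors, [analysis], exactly as for the tree's
`T4InputCauchyRateSecant.TermHistExpLinearN`; NOT PRINTED as a statement over a class): at every class point `q` of step `k`, for
every factor `(Z, j)` of every tuple localizing at a step-`k` domain, the factor's history functional is a.e. bounded IN UNITS
`r k` (the consumer's history margin): `‖D.Λ Z j q.1 a‖·r k ≤ N k g U Z j`. -/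
def ActExpNormBound (K : ℕ → (ℕ → ℝ) → C.BgB → Set (Op × Hist)) (W : Set (ℕ → ℝ)) (r : ℕ → ℝ)
    (N : ℕ → (ℕ → ℝ) → C.BgB → P → J → ℝ) : Prop :=
  ∀ k, ∀ g ∈ W, ∀ (U : C.BgB) (q : Op × Hist), q ∈ K k g U → ∀ X : C.Dom, C.scale X = k →
    ∀ i, 𝒯.Rel k i X → ∀ m, ∀ᵐ a ∂(D.ν (𝒯.poly i m) (𝒯.lab i m) q.1),
      ‖D.Λ (𝒯.poly i m) (𝒯.lab i m) q.1 a‖ * r k ≤ N k g U (𝒯.poly i m) (𝒯.lab i m)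

/-- [folklore] HYPOTHESIS SHAPE `ActAbsBound 𝒯 D K W A` (PARAMETRISED, asserted nowhere; printed KIND: (2.15) p. 15 of
[Balaban1988RG2Cluster] bounds the MODULUS of the term (2.14) by the integral of the moduli with the potentials under
`exp[Σ_{Y∈𝐃} |τ(Y)||𝐕_k(Y,B)|]`, and Lemma 3 (2.38) p. 20 is the resulting activity bound — locators only; NOT PRINTED as a
statement over a class): at every class point `q` of step `k`, every factor `(Z, j)` of every tuple localizing at a step-`k`
domain has ABSOLUTE majorant `∫ ‖D.Φ Z j q.1 a‖·‖exp(D.Λ Z j q.1 a q.2)‖ dν(Z j q.1) ≤ A k g U Z j`. -/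
def ActAbsBound (K : ℕ → (ℕ → ℝ) → C.BgB → Set (Op × Hist)) (W : Set (ℕ → ℝ))
    (A : ℕ → (ℕ → ℝ) → C.BgB → P → J → ℝ) : Prop :=
  ∀ k, ∀ g ∈ W, ∀ (U : C.BgB) (q : Op × Hist), q ∈ K k g U → ∀ X : C.Dom, C.scale X = k →
    ∀ i, 𝒯.Rel k i X → ∀ m,
      ∫ a, ‖D.Φ (𝒯.poly i m) (𝒯.lab i m) q.1 a‖ * ‖Complex.exp (D.Λ (𝒯.poly i m) (𝒯.lab i m) q.1 a q.2)‖
          ∂(D.ν (𝒯.poly i m) (𝒯.lab i m) q.1) ≤ A k g U (𝒯.poly i m) (𝒯.lab i m)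

/-- [folklore] THE SECANT MAJORANT of an Ursell term induced by per-activity exponent bounds `N` and activity majorants `A`:
`(Σ_m N (poly i m) (lab i m)) · actMajorant A k X i` (zero off the localization relation). -/
def secMajorant (N A : P → J → ℝ) (k : ℕ) (X : C.Dom) (i : ι) : ℝ :=
  (∑ m, N (𝒯.poly i m) (𝒯.lab i m)) * actMajorant 𝒯 inc A k X i

variable {𝒯 inc act D}

/-- [folklore] Off the localization relation the secant majorant vanishes. -/
theorem secMajorant_of_not_rel {N A : P → J → ℝ} {k : ℕ} {i : ι} {X : C.Dom} (h : ¬ 𝒯.Rel k i X) :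
    secMajorant 𝒯 inc N A k X i = 0 := by
  rw [secMajorant, actMajorant_of_not_rel h, mul_zero]

/-- [folklore] The secant majorant is nonnegative for nonnegative exponent bounds and activity majorants. -/
theorem secMajorant_nonneg {N A : P → J → ℝ} (hN : ∀ Z j, 0 ≤ N Z j) (hA : ∀ Z j, 0 ≤ A Z j) (k : ℕ) (X : C.Dom) (i : ι) :
    0 ≤ secMajorant 𝒯 inc N A k X i :=
  mul_nonneg (Finset.sum_nonneg fun _ _ => hN _ _) (actMajorant_nonneg hA k X i)

/-- [folklore] **ABSOLUTE ⟹ NORM MAJORANT**: under the structure `ActExpLinearOn` (each activity term IS `∫ Φ·e^{Λ h} dν` at class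
points) the absolute majorant bounds the activity term itself — so leaf-04's `termRep_b13_of_actBound`∕`classBound_b13_of_actBound`
and the Cauchy face (`B13TermHistEnvelope.histFibreEnvelopeCl_b13_of_actBound`) consume the SAME displayed datum `A`. -/
theorem actNormBound_of_abs {K : ℕ → (ℕ → ℝ) → C.BgB → Set (Op × Hist)} {W : Set (ℕ → ℝ)}
    {A : ℕ → (ℕ → ℝ) → C.BgB → P → J → ℝ} (hexp : ActExpLinearOn 𝒯 act D K W) (habs : ActAbsBound 𝒯 D K W A) :
    ∀ k, ∀ g ∈ W, ∀ (U : C.BgB) (q : Op × Hist), q ∈ K k g U → ∀ X : C.Dom, C.scale X = k →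
      ∀ i, 𝒯.Rel k i X → ∀ m, ‖act (𝒯.poly i m) (𝒯.lab i m) q.1 q.2‖ ≤ A k g U (𝒯.poly i m) (𝒯.lab i m) := by
  intro k g hg U q hq X hX i hi m
  rw [hexp.repr k g hg U q hq X hX i hi m]
  refine (norm_integral_le_integral_norm _).trans (le_trans (le_of_eq ?_) (habs k g hg U q hq X hX i hi m))
  exact integral_congr_ae (Filter.Eventually.of_forall fun a => norm_mul _ _)

/-- [folklore] THE ENDPOINT ABSOLUTE MAJORANT OF AN URSELL TERM IS THE PRODUCT OF ITS FACTORS': at a class point `(o, y)`, for a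
tuple localizing at `X`, `∫ ‖tupleWeight a‖·‖exp(tupleFunctional a y)‖ d(tupleMeasure) ≤ actMajorant A k X i` — Fubini on
`Measure.pi` (`integral_fintype_prod_eq_prod`), `‖exp Σ_m‖ = Π_m ‖exp‖`, and `ActAbsBound` factor by factor. -/
theorem absMajorant_tuple_le {K : ℕ → (ℕ → ℝ) → C.BgB → Set (Op × Hist)} {W : Set (ℕ → ℝ)}
    {A : ℕ → (ℕ → ℝ) → C.BgB → P → J → ℝ} (hexp : ActExpLinearOn 𝒯 act D K W) (habs : ActAbsBound 𝒯 D K W A)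
    {k : ℕ} {g : ℕ → ℝ} (hg : g ∈ W) {U : C.BgB} {o : Op} {y : Hist} (hq : (o, y) ∈ K k g U) {X : C.Dom}
    (hX : C.scale X = k) {i : ι} (hR : 𝒯.Rel k i X) :
    ∫ a, ‖tupleWeight 𝒯 inc D k i o X a‖ * ‖Complex.exp (tupleFunctional 𝒯 D k i o X a y)‖ ∂(tupleMeasure 𝒯 D i o)
      ≤ actMajorant 𝒯 inc (A k g U) k X i := by
  have hsf : ∀ m, SigmaFinite (D.ν (𝒯.poly i m) (𝒯.lab i m) o) := hexp.sigmaFinite k g hg U (o, y) hq X hX i hR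
  have hpt : (fun a => ‖tupleWeight 𝒯 inc D k i o X a‖ * ‖Complex.exp (tupleFunctional 𝒯 D k i o X a y)‖) =
      fun a => ‖coeff 𝒯 inc i‖ * ∏ m, (‖D.Φ (𝒯.poly i m) (𝒯.lab i m) o (a m)‖ *
        ‖Complex.exp (D.Λ (𝒯.poly i m) (𝒯.lab i m) o (a m) y)‖) := by
    funext a
    have hW : tupleWeight 𝒯 inc D k i o X a = coeff 𝒯 inc i * ∏ m, D.Φ (𝒯.poly i m) (𝒯.lab i m) o (a m) := if_pos hR
    have hΛ : tupleFunctional 𝒯 D k i o X a = ∑ m, D.Λ (𝒯.poly i m) (𝒯.lab i m) o (a m) := if_pos hR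
    rw [hW, hΛ, norm_mul, norm_prod, _root_.sum_apply, Complex.exp_sum, norm_prod, mul_assoc,
      ← Finset.prod_mul_distrib]
  rw [hpt, integral_const_mul, actMajorant_of_rel hR, tupleMeasure,
    integral_fintype_prod_eq_prod
      (f := fun m a => ‖D.Φ (𝒯.poly i m) (𝒯.lab i m) o a‖ * ‖Complex.exp (D.Λ (𝒯.poly i m) (𝒯.lab i m) o a y)‖)]
  refine mul_le_mul_of_nonneg_left (Finset.prod_le_prod (fun m _ => integral_nonneg fun a => ?_) fun m _ => ?_) (norm_nonneg _)
  · exact mul_nonneg (norm_nonneg _) (norm_nonneg _)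
  · exact habs k g hg U (o, y) hq X hX i hR m

/-- [folklore] THE NAMED EXPONENT BOUND OF AN URSELL TERM: under `ActExpNormBound … r N` the tuple's history functional is a.e.
bounded by `(Σ_m N_m)∕r k` on the product measure (bounds transported along the evaluations, `Measure.tendsto_eval_ae_ae`). -/
theorem normBound_tupleFunctional {K : ℕ → (ℕ → ℝ) → C.BgB → Set (Op × Hist)} {W : Set (ℕ → ℝ)} {r : ℕ → ℝ}
    {N : ℕ → (ℕ → ℝ) → C.BgB → P → J → ℝ} (hexp : ActExpLinearOn 𝒯 act D K W) (hN : ActExpNormBound 𝒯 D K W r N)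
    {k : ℕ} (hr : 0 < r k) {g : ℕ → ℝ} (hg : g ∈ W) {U : C.BgB} {o : Op} {y : Hist} (hq : (o, y) ∈ K k g U) {X : C.Dom}
    (hX : C.scale X = k) {i : ι} (hR : 𝒯.Rel k i X) :
    ∀ᵐ a ∂(tupleMeasure 𝒯 D i o),
      ‖tupleFunctional 𝒯 D k i o X a‖ ≤ (∑ m, N k g U (𝒯.poly i m) (𝒯.lab i m)) / r k := by
  have hsf : ∀ m, SigmaFinite (D.ν (𝒯.poly i m) (𝒯.lab i m) o) := hexp.sigmaFinite k g hg U (o, y) hq X hX i hR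
  have hall : ∀ᵐ a ∂(tupleMeasure 𝒯 D i o),
      ∀ m, ‖D.Λ (𝒯.poly i m) (𝒯.lab i m) o (a m)‖ * r k ≤ N k g U (𝒯.poly i m) (𝒯.lab i m) := by
    rw [Filter.eventually_all]
    intro m
    exact (Measure.tendsto_eval_ae_ae (μ := fun m => D.ν (𝒯.poly i m) (𝒯.lab i m) o) (i := m)).eventually
      (hN k g hg U (o, y) hq X hX i hR m)
  filter_upwards [hall] with a ha
  have hΛ : tupleFunctional 𝒯 D k i o X a = ∑ m, D.Λ (𝒯.poly i m) (𝒯.lab i m) o (a m) := if_pos hR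
  rw [hΛ, le_div_iff₀ hr]
  calc ‖∑ m, D.Λ (𝒯.poly i m) (𝒯.lab i m) o (a m)‖ * r k
      ≤ (∑ m, ‖D.Λ (𝒯.poly i m) (𝒯.lab i m) o (a m)‖) * r k := mul_le_mul_of_nonneg_right (norm_sum_le _ _) hr.le
    _ = ∑ m, ‖D.Λ (𝒯.poly i m) (𝒯.lab i m) o (a m)‖ * r k := Finset.sum_mul _ _ _
    _ ≤ ∑ m, N k g U (𝒯.poly i m) (𝒯.lab i m) := Finset.sum_le_sum fun m _ => ha m

section PerTerm

variable [NormedAddCommGroup Op] [NormedSpace ℂ Op]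

/-- [folklore] **THE SECANT OF ONE URSELL TERM UNDER THE PRODUCT INTEGRAL.**  For a step model `M` (only its history margin
`rHist` is read), the structure `ActExpLinearOn`, the named exponent bounds `ActExpNormBound … M.rHist N` and the absolute
majorants `ActAbsBound … A`: at any two class points `(o, h)`, `(o, h′)` of step `k` and any step-`k` domain `X`,
`‖term k i o h′ X − term k i o h X‖ ≤ 2·secMajorant (N k g U) (A k g U) k X i·(‖h′ − h‖∕rHist k)` — the tree's kernel
`norm_integral_mul_cexp_sub_le` (secant of the exponential under the integral sign, NO reach condition) on leaf-08's product data,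
with the two endpoint majorants bounded by `absMajorant_tuple_le`.  The factor `2` is the two endpoints. -/
theorem norm_term_sub_term_le (M : StepModel C Op Hist) {K : ℕ → (ℕ → ℝ) → C.BgB → Set (Op × Hist)} {W : Set (ℕ → ℝ)}
    {N A : ℕ → (ℕ → ℝ) → C.BgB → P → J → ℝ} (hexp : ActExpLinearOn 𝒯 act D K W)
    (hN : ActExpNormBound 𝒯 D K W M.rHist N) (habs : ActAbsBound 𝒯 D K W A) (hN0 : ∀ k g U Z j, 0 ≤ N k g U Z j)
    {k : ℕ} {g : ℕ → ℝ} (hg : g ∈ W) {U : C.BgB} {o : Op} {h h' : Hist} (hq : (o, h) ∈ K k g U)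
    (hq' : (o, h') ∈ K k g U) {X : C.Dom} (hX : C.scale X = k) (i : ι) :
    ‖term 𝒯 inc act k i o h' X - term 𝒯 inc act k i o h X‖
      ≤ 2 * secMajorant 𝒯 inc (N k g U) (A k g U) k X i * (‖h' - h‖ / M.rHist k) := by
  by_cases hR : 𝒯.Rel k i X
  · have hr := M.rHist_pos k
    obtain ⟨hW, hLm, -, hT⟩ := termHistExpLinear_of_actExpLinear (inc := inc) hexp k g hg U (o, h) hq X hX i
    obtain ⟨-, -, -, hT'⟩ := termHistExpLinear_of_actExpLinear (inc := inc) hexp k g hg U (o, h') hq' X hX i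
    dsimp only at hW hLm hT hT'
    have hLbd := normBound_tupleFunctional hexp hN hr hg hq hX hR
    have key := norm_integral_mul_cexp_sub_le (tupleMeasure 𝒯 D i o) (tupleWeight 𝒯 inc D k i o X)
      (tupleFunctional 𝒯 D k i o X) hW hLm hLbd h h'
    have hE := absMajorant_tuple_le (inc := inc) hexp habs hg hq hX hR
    have hE' := absMajorant_tuple_le (inc := inc) hexp habs hg hq' hX hR
    have hNn : 0 ≤ (∑ m, N k g U (𝒯.poly i m) (𝒯.lab i m)) / M.rHist k :=
      div_nonneg (Finset.sum_nonneg fun m _ => hN0 _ _ _ _ _) hr.le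
    rw [hT, hT']
    refine key.trans ?_
    calc (∑ m, N k g U (𝒯.poly i m) (𝒯.lab i m)) / M.rHist k * ‖h' - h‖ *
          ((∫ a, ‖tupleWeight 𝒯 inc D k i o X a‖ * ‖Complex.exp (tupleFunctional 𝒯 D k i o X a h)‖ ∂(tupleMeasure 𝒯 D i o)) +
            ∫ a, ‖tupleWeight 𝒯 inc D k i o X a‖ * ‖Complex.exp (tupleFunctional 𝒯 D k i o X a h')‖ ∂(tupleMeasure 𝒯 D i o))
        ≤ (∑ m, N k g U (𝒯.poly i m) (𝒯.lab i m)) / M.rHist k * ‖h' - h‖ *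
          (2 * actMajorant 𝒯 inc (A k g U) k X i) :=
          mul_le_mul_of_nonneg_left (by linarith) (mul_nonneg hNn (norm_nonneg _))
      _ = 2 * secMajorant 𝒯 inc (N k g U) (A k g U) k X i * (‖h' - h‖ / M.rHist k) := by
          rw [secMajorant]; ring
  · rw [term_of_not_rel 𝒯 inc act hR, term_of_not_rel 𝒯 inc act hR, sub_zero, norm_zero, secMajorant_of_not_rel hR,
      mul_zero, zero_mul]

/-- [folklore] **THE SECANT FACE OF L04-hist AT ACTIVITY LEVEL — `HistSecant` FROM PER-ACTIVITY DATA, PER-DOMAIN CURRENCY.**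
For ANY step model with `M.Out = out 𝒯 inc act`: leaf-08's STRUCTURE `ActExpLinearOn 𝒯 act D K W`; the per-activity displayed
binders `ActExpNormBound … M.rHist N` ((2.18)∕(2.20) KIND) and `ActAbsBound … A` ((2.15)∕(2.38) KIND) with `N ≥ 0`; row O1-d3's
convergence binder `Summable (actMajorant (A k g U) k X)` ([26]∕(2.39)–(2.40) KIND); and a PER-DOMAIN FIRST-MOMENT budget
`Summable (secMajorant (N k g U) (A k g U) k X) ∧ Σ'ᵢ secMajorant … ≤ G₁·e^{−κd(X)}` (a resummation of the printed KIND, exactly as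
the tree's `histSecant_of_expLinear` budget `Σᵢ Nᵢaᵢ ≤ G₁`, here with the decay extracted per domain as in (2.41) p. 21) ⟹
**`HistSecant M K W κ (2·G₁)`** — the CLASS-WIDE history modulus with NO reach, NO slack, NO room and NO analyticity hypothesis;
literally the `hsec` binder of `T4InputCauchyRateSecant.ne5_at_of_stepModel_secant_scale_nat`. -/
theorem histSecant_b13_of_act {M : StepModel C Op Hist} (hM : ∀ k o h X, M.Out k o h X = out 𝒯 inc act k o h X)
    {K : ℕ → (ℕ → ℝ) → C.BgB → Set (Op × Hist)} {W : Set (ℕ → ℝ)} {N A : ℕ → (ℕ → ℝ) → C.BgB → P → J → ℝ} {κ G₁ : ℝ}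
    (hexp : ActExpLinearOn 𝒯 act D K W) (hN : ActExpNormBound 𝒯 D K W M.rHist N) (habs : ActAbsBound 𝒯 D K W A)
    (hN0 : ∀ k g U Z j, 0 ≤ N k g U Z j)
    (hconv : ∀ k, ∀ g ∈ W, ∀ (U : C.BgB) (X : C.Dom), C.scale X = k → Summable (actMajorant 𝒯 inc (A k g U) k X))
    (hmom : ∀ k, ∀ g ∈ W, ∀ (U : C.BgB) (X : C.Dom), C.scale X = k →
      Summable (secMajorant 𝒯 inc (N k g U) (A k g U) k X) ∧
        ∑' i, secMajorant 𝒯 inc (N k g U) (A k g U) k X i ≤ G₁ * Real.exp (-(κ * C.d X))) :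
    HistSecant M K W κ (2 * G₁) := by
  have hA := actNormBound_of_abs hexp habs
  intro k g hg U o h h' hq hq' X hX
  have hs : ∀ y, (o, y) ∈ K k g U → HasSum (fun i => term 𝒯 inc act k i o y X) (M.Out k o y X) := fun y hy => by
    rw [hM]
    exact hasSum_term_out 𝒯 inc act (summable_term_of_actBound (hA k g hg U (o, y) hy X hX) (hconv k g hg U X hX))
  obtain ⟨hsm, hle⟩ := hmom k g hg U X hX
  have hd : 0 ≤ ‖h' - h‖ / M.rHist k := div_nonneg (norm_nonneg _) (M.rHist_pos k).le
  have h1 : ‖M.Out k o h' X - M.Out k o h X‖ ≤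
      (∑' i, secMajorant 𝒯 inc (N k g U) (A k g U) k X i) * (2 * (‖h' - h‖ / M.rHist k)) :=
    ((hs h' hq').sub (hs h hq)).norm_le_of_bounded (hsm.hasSum.mul_right _) fun i =>
      (norm_term_sub_term_le M hexp hN habs hN0 hg hq hq' hX i).trans (le_of_eq (by ring))
  calc ‖M.Out k o h' X - M.Out k o h X‖
      ≤ (∑' i, secMajorant 𝒯 inc (N k g U) (A k g U) k X i) * (2 * (‖h' - h‖ / M.rHist k)) := h1
    _ ≤ G₁ * Real.exp (-(κ * C.d X)) * (2 * (‖h' - h‖ / M.rHist k)) :=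
        mul_le_mul_of_nonneg_right hle (mul_nonneg zero_le_two hd)
    _ = 2 * G₁ * (‖h' - h‖ / M.rHist k) * Real.exp (-(κ * C.d X)) := by ring

end PerTerm

end Secant

/-! ## §2 The secant face for the MODEL OF RECORD `B13Represents.Assembly.step` -/

section ModelOfRecord

variable {C : Carriers} {E IOp Hist ι P J Ω : Type*} [NormedAddCommGroup Hist] [NormedSpace ℂ Hist] [MeasurableSpace Ω]
  (𝔄 : Assembly C E IOp Hist ι P J) (BHist : ℕ → ℝ)

/-- [folklore] **L04-hist, SECANT FACE, FOR THE ASSEMBLED STEP MODEL** on ANY class `K` (no room, no slack): structure +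
per-activity exponent bounds in the model's history margins + absolute activity majorants + d3's convergence + per-domain
first-moment budget ⟹ `HistSecant (𝔄.step BHist) K W κ (2·G₁)`. -/
theorem histSecant_step_of_act {K : ℕ → (ℕ → ℝ) → C.BgB → Set (OpDatum E × Hist)} {W : Set (ℕ → ℝ)}
    {N A : ℕ → (ℕ → ℝ) → C.BgB → P → J → ℝ} {κ G₁ : ℝ} {D : ActData P J (OpDatum E) Hist Ω}
    (hexp : ActExpLinearOn 𝔄.𝒯 𝔄.act D K W) (hN : ActExpNormBound 𝔄.𝒯 D K W 𝔄.rHist N) (habs : ActAbsBound 𝔄.𝒯 D K W A)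
    (hN0 : ∀ k g U Z j, 0 ≤ N k g U Z j)
    (hconv : ∀ k, ∀ g ∈ W, ∀ (U : C.BgB) (X : C.Dom), C.scale X = k → Summable (actMajorant 𝔄.𝒯 𝔄.inc (A k g U) k X))
    (hmom : ∀ k, ∀ g ∈ W, ∀ (U : C.BgB) (X : C.Dom), C.scale X = k →
      Summable (secMajorant 𝔄.𝒯 𝔄.inc (N k g U) (A k g U) k X) ∧
        ∑' i, secMajorant 𝔄.𝒯 𝔄.inc (N k g U) (A k g U) k X i ≤ G₁ * Real.exp (-(κ * C.d X))) :
    HistSecant (𝔄.step BHist) K W κ (2 * G₁) :=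
  histSecant_b13_of_act (M := 𝔄.step BHist) (fun _ _ _ _ => rfl) hexp hN habs hN0 hconv hmom

end ModelOfRecord

/-! ## §3 Route P2's term data with linear read-outs: the exponent bound BY NAME, the absolute majorant IDENTIFIED -/

section LinearHistory

variable {Op Hist ι κ S Ω Ω₀ 𝒴 𝒞 : Type*} [MeasurableSpace Ω] [MeasurableSpace Ω₀] [NormedAddCommGroup Hist]
  [NormedSpace ℂ Hist] [Fintype ι] [Fintype κ] [DecidableEq ι] [DecidableEq κ]

/-- [folklore] IDENTIFICATION (one term): the absolute majorant's integrand of leaf-08's exhibited data IS P2's tilted integrand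
over the normalisation — `‖weight 𝔱 o x‖·‖exp(histCLM 𝔱 L x h)‖ = ‖(z o)⁻¹‖·‖F (o,h) x‖` (by `F_eq_mul_cexp`). -/
theorem absIntegrand_weight_eq (𝔱 : TermDatum Op Hist ι κ S Ω Ω₀ 𝒴 𝒞) {L : 𝒴 → Ω → (Hist →L[ℂ] ℂ)}
    (hread : ∀ h Y x, 𝔱.read h Y x = L Y x h) (o : Op) (h : Hist) (x : Ω) :
    ‖weight 𝔱 o x‖ * ‖Complex.exp (histCLM 𝔱 L x h)‖ = ‖(𝔱.z o)⁻¹‖ * ‖𝔱.F (o, h) x‖ := by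
  rw [F_eq_mul_cexp hread, weight]
  simp only [norm_mul]
  ring

variable {C : Carriers} {ιT P J : Type*} {𝒯 : TermIndexing C ιT P J} {𝔱 : P → J → TermDatum Op Hist ι κ S Ω Ω₀ 𝒴 𝒞}
  {L : P → J → 𝒴 → Ω → (Hist →L[ℂ] ℂ)} {ϱ : P → J → ℝ} {K : ℕ → (ℕ → ℝ) → C.BgB → Set (Op × Hist)} {W : Set (ℕ → ℝ)}

/-- [folklore] **THE EXPONENT BOUND DISCHARGED BY NAME for route P2's term data with linear read-outs**, per-activity form:
if every term's history read-out IS the continuous linear family `L` (`read h Y x = L Y x h`) and obeys P2's one-run shape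
`ReadUnitBound` with margin `ϱ Z j > 0` and nonnegative weights `v` (for the B13 read-out `readVpp` through the measurable table
these are leaf-06's `B13HistReadout.readVpp_eq_clm` ∕ `readUnitBound_readVpp`, p209145, BY NAME — the (1.36)×(2.18) format),
then `ActExpNormBound 𝒯 (dataOf 𝔱 L) K W r N` holds with `N k g U Z j = r k·(Σ_{Y∈𝐃(Z j)} v Y)∕ϱ Z j` for every nonnegative unit
`r` — EVERYWHERE in the integration point (`B13StepTermExpLinear.norm_histCLM_le`), a fortiori a.e.; on every class. -/
theorem actExpNormBound_of_readUnitBound (hread : ∀ Z j (h : Hist) (Y : 𝒴) (x : Ω), (𝔱 Z j).read h Y x = L Z j Y x h)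
    (hpos : ∀ Z j, 0 < ϱ Z j) (hnonneg : ∀ Z j, ∀ Y ∈ (𝔱 Z j).D, 0 ≤ (𝔱 Z j).v Y)
    (hunit : ∀ Z j, ReadUnitBound (𝔱 Z j).read (𝔱 Z j).D (𝔱 Z j).τ (𝔱 Z j).v (ϱ Z j)) {r : ℕ → ℝ} (hr : ∀ k, 0 ≤ r k) :
    ActExpNormBound 𝒯 (dataOf 𝔱 L) K W r
      (fun k _ _ Z j => r k * ((∑ Y ∈ (𝔱 Z j).D, (𝔱 Z j).v Y) / ϱ Z j)) :=
  fun k _ _ _ _ _ _ _ i _ m => Filter.Eventually.of_forall fun x => by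
    rw [mul_comm]
    exact mul_le_mul_of_nonneg_left
      (norm_histCLM_le (hread (𝒯.poly i m) (𝒯.lab i m)) (hpos _ _) (hnonneg _ _) (hunit _ _) x) (hr k)

/-- [folklore] The same read off leaf-08's bundled shape `LinearHistoryOn 𝒯 𝔱 L ϱ K W` (its fields `read`∕`pos`∕`nonneg`∕`unit`). -/
theorem actExpNormBound_of_linearHistory (hL : LinearHistoryOn 𝒯 𝔱 L ϱ K W) {r : ℕ → ℝ} (hr : ∀ k, 0 ≤ r k) :
    ActExpNormBound 𝒯 (dataOf 𝔱 L) K W r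
      (fun k _ _ Z j => r k * ((∑ Y ∈ (𝔱 Z j).D, (𝔱 Z j).v Y) / ϱ Z j)) :=
  actExpNormBound_of_readUnitBound hL.read hL.pos hL.nonneg hL.unit hr

/-- [folklore] **THE ABSOLUTE MAJORANT OF ROUTE P2's TERM DATA READS AS THE (2.15) QUANTITY**: if every term's history read-out IS
the CLM family `L` and at every class point `q` of step `k`, every factor `(Z, j)` of every tuple localizing at a step-`k` domain has
`‖(z q.1)⁻¹‖·∫ ‖F (q) x‖ dν ≤ A k g U Z j` (the L¹ size of P2's tilted integrand over the normalisation modulus — P2's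
`RefAt.hF`∕`hM'`∕`hζ` KIND, [Balaban1988RG2Cluster] (2.15) p. 15; displayed, locator only), then `ActAbsBound 𝒯 (dataOf 𝔱 L) K W A`
(by the identification `absIntegrand_weight_eq`; no integrability hypothesis is needed for the rewriting). -/
theorem actAbsBound_of_normF (hread : ∀ Z j (h : Hist) (Y : 𝒴) (x : Ω), (𝔱 Z j).read h Y x = L Z j Y x h)
    {A : ℕ → (ℕ → ℝ) → C.BgB → P → J → ℝ}
    (hF : ∀ k, ∀ g ∈ W, ∀ (U : C.BgB) (q : Op × Hist), q ∈ K k g U → ∀ X : C.Dom, C.scale X = k →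
      ∀ i, 𝒯.Rel k i X → ∀ m,
        ‖((𝔱 (𝒯.poly i m) (𝒯.lab i m)).z q.1)⁻¹‖ * ∫ x, ‖(𝔱 (𝒯.poly i m) (𝒯.lab i m)).F q x‖
            ∂(𝔱 (𝒯.poly i m) (𝒯.lab i m)).ν ≤ A k g U (𝒯.poly i m) (𝒯.lab i m)) :
    ActAbsBound 𝒯 (dataOf 𝔱 L) K W A := by
  intro k g hg U q hq X hX i hi m
  have h := hF k g hg U q hq X hX i hi m
  have heq : (fun x => ‖(dataOf 𝔱 L).Φ (𝒯.poly i m) (𝒯.lab i m) q.1 x‖ *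
      ‖Complex.exp ((dataOf 𝔱 L).Λ (𝒯.poly i m) (𝒯.lab i m) q.1 x q.2)‖) =
      fun x => ‖((𝔱 (𝒯.poly i m) (𝒯.lab i m)).z q.1)⁻¹‖ * ‖(𝔱 (𝒯.poly i m) (𝒯.lab i m)).F q x‖ := by
    funext x
    exact absIntegrand_weight_eq (𝔱 (𝒯.poly i m) (𝒯.lab i m)) (hread _ _) q.1 q.2 x
  show ∫ x, ‖(dataOf 𝔱 L).Φ (𝒯.poly i m) (𝒯.lab i m) q.1 x‖ *
      ‖Complex.exp ((dataOf 𝔱 L).Λ (𝒯.poly i m) (𝒯.lab i m) q.1 x q.2)‖ ∂(𝔱 (𝒯.poly i m) (𝒯.lab i m)).ν ≤ _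
  rw [heq, integral_const_mul]
  exact h

/-- [folklore] The same read off leaf-08's bundled shape `LinearHistoryOn` (its field `read`). -/
theorem actAbsBound_of_linearHistory_normF (hL : LinearHistoryOn 𝒯 𝔱 L ϱ K W) {A : ℕ → (ℕ → ℝ) → C.BgB → P → J → ℝ}
    (hF : ∀ k, ∀ g ∈ W, ∀ (U : C.BgB) (q : Op × Hist), q ∈ K k g U → ∀ X : C.Dom, C.scale X = k →
      ∀ i, 𝒯.Rel k i X → ∀ m,
        ‖((𝔱 (𝒯.poly i m) (𝒯.lab i m)).z q.1)⁻¹‖ * ∫ x, ‖(𝔱 (𝒯.poly i m) (𝒯.lab i m)).F q x‖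
            ∂(𝔱 (𝒯.poly i m) (𝒯.lab i m)).ν ≤ A k g U (𝒯.poly i m) (𝒯.lab i m)) :
    ActAbsBound 𝒯 (dataOf 𝔱 L) K W A :=
  actAbsBound_of_normF hL.read hF

end LinearHistory

end Summit.QuantumFields.BalabanUV.T4Continuum.B13TermHistSecant

end
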